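import Mathlib
import Literature.NumberTheory.Transcendental.KZCalculusProofs
import Literature.NumberTheory.Transcendental.SemialgebraicMapsProofs
import Literature.NumberTheory.Transcendental.KZSemialgebraicComplex
import Summits.KontsevichZagierPeriods.KontsevichZagierPeriods.Theorems.HyperbolicBlochOffTetraSectorKernelLadderFamilyExists
import Summits.KontsevichZagierPeriods.KontsevichZagierPeriods.Theorems.HyperbolicBlochOffTetraSectorKernelStubThreeTrianglesConfig

/-!
# `OffTetraSectorKernel`, line `odd-hyperbolic-ladder`: the boundary rotation move (stub `stub_threeTriangles`, aux)

Rung 1 of the hyperbolic scissors ladder lives in the upper half-plane `{p : Fin 2 → ℝ | 0 < p 1}` with the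
area density `1 / t²` (`x = p 0`, `t = p 1`). The standard doubly-ideal triangle is
`Std γ = {γ < x < 1, 0 < t, 1 < x² + t²}` (vertices `∞`, `1`, `(γ, √(1-γ²))`; area `arccos γ`).

This file proves the one genuinely non-additive move behind the three-triangle relation: for
`b = cos B ∈ (-1, 1)` the **boundary rotation by the angle `B`**,
`Φ_b (x, t) = (b x − √(1−b²) √(1−x²), t · (b √(1−x²) + √(1−b²) x) / √(1−x²))`
(i.e. `x = cos θ ↦ cos (θ + B)` on the boundary circle, extended linearly in `t` with the factor
`d cos(θ+B) / d cos θ = sin(θ+B)/sin θ`), is a `ℚ`-semialgebraic injective change of variables on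
`Std a` whenever `arccos a + B ≤ π` (`⇔ 0 ≤ a + b`), with triangular Jacobian of determinant
`(sin(θ+B)/sin θ)²`, mapping `Std a` onto the V-piece `{cos(A+B) < x < b, 0 < t, 1 < x² + t²}` and
satisfying `t⁻² = (Φ_b p)₁⁻² · |det DΦ_b|`. Hence `[Std a, t⁻²] ≡ [{cos(A+B) < x < cos B, t > √(1-x²)}, t⁻²]`
by ONE instance of Kontsevich–Zagier's rule (2) (`KZ.changeOfVariablesRel`): the area `arccos`-integral is
translated along the boundary circle by an algebraic angle.

As in `…StubThreeTrianglesConfig`, no definition is introduced: `S, g, h, Φ` are function symbols constrained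
by `hS : S x = √(1−x²)`, `hg : g b x = b x − S b · S x`, `hh : h b x = b · S x + S b · x`,
`hΦ : Φ b p = (g b (p 0), p 1 · h b (p 0) / S (p 0))`.

References: M. Kontsevich, D. Zagier, *Periods* (2001), §1.1 (the `π` example), §1.2 rule (2);
J. Bochnak, M. Coste, M.-F. Roy, *Real Algebraic Geometry* (1998), Prop. 2.2.6.
-/

noncomputable section

open Set MeasureTheory MvPolynomial
open Literature.NumberTheory.Transcendental Literature.ModelTheory.ExponentialFields

namespace Summit.KontsevichZagierPeriods.HyperbolicBloch.OffTetraSectorKernel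

variable {S : ℝ → ℝ} {g h : ℝ → ℝ → ℝ} {Φ : ℝ → (Fin 2 → ℝ) → Fin 2 → ℝ}

/-! ### The rotation as a map of the half-plane -/

/-- The rotation `Φ_b` is a `ℚ`-semialgebraic map on every `ℚ`-semialgebraic `σ ⊆ {|x| < 1}` (for real
algebraic `b`): its coordinates are built from the coordinates, real algebraic constants, `√` and the rational
function `1/(1 − x²)` by sums and products (Tarski–Seidenberg). [cite: BochnakCosteRoy1998, Prop. 2.2.6] -/
theorem threeTri_rot_isSemialgebraicMapOn (hS : ∀ x, S x = Real.sqrt (1 - x ^ 2))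
    (hg : ∀ b x, g b x = b * x - S b * S x) (hh : ∀ b x, h b x = b * S x + S b * x)
    (hΦ : ∀ b p, Φ b p = ![g b (p 0), p 1 * (h b (p 0) / S (p 0))]) {b : ℝ} (hb : IsAlgebraic ℚ b)
    {σ : Set (Fin 2 → ℝ)} (hσ : IsSemialgebraic ℚ σ) (hσ1 : ∀ p ∈ σ, -1 < p 0 ∧ p 0 < 1) :
    IsSemialgebraicMapOn ℚ σ (Φ b) := by
  have hx : ∀ i : Fin 2, IsSemialgebraicFunOn ℚ σ (fun p => p i) := fun i =>
    (isSemialgebraicFunOn_apply_univ i).mono (subset_univ _) hσ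
  have hc : ∀ {c : ℝ}, IsAlgebraic ℚ c → IsSemialgebraicFunOn ℚ σ (fun _ => c) := fun hc =>
    isSemialgebraicFunOn_const_of_isAlgebraic hσ hc
  -- `p ↦ S (p 0)`
  have hS' : IsSemialgebraicFunOn ℚ σ (fun p => S (p 0)) := by
    have h1 : IsSemialgebraicFunOn ℚ σ (fun p => 1 - p 0 ^ 2) :=
      (IsSemialgebraicFunOn.sub_holds (hc isAlgebraic_one)
        (IsSemialgebraicFunOn.mul_holds (hx 0) (hx 0))).congr fun p _ => by simp [sq]
    exact (IsSemialgebraicFunOn.sqrt_holds h1).congr fun p _ => (hS (p 0)).symm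
  have hg' : IsSemialgebraicFunOn ℚ σ (fun p => g b (p 0)) :=
    (IsSemialgebraicFunOn.sub_holds (IsSemialgebraicFunOn.mul_holds (hc hb) (hx 0))
      (IsSemialgebraicFunOn.mul_holds (hc (threeTri_isAlgebraic_S hS hb)) hS')).congr fun p _ => by
        simp only [Pi.sub_apply, Pi.mul_apply, hg]
  have hh' : IsSemialgebraicFunOn ℚ σ (fun p => h b (p 0)) :=
    (IsSemialgebraicFunOn.add_holds (IsSemialgebraicFunOn.mul_holds (hc hb) hS')
      (IsSemialgebraicFunOn.mul_holds (hc (threeTri_isAlgebraic_S hS hb)) (hx 0))).congr fun p _ => by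
        simp only [Pi.add_apply, Pi.mul_apply, hh]
  -- `1 / (1 - x²)` as a rational function with non-vanishing denominator
  have hinv : IsSemialgebraicFunOn ℚ σ (fun p => 1 / (1 - p 0 ^ 2)) := by
    have hq : ∀ p ∈ σ, aeval p (1 - X 0 ^ 2 : MvPolynomial (Fin 2) ℚ) ≠ 0 := fun p hp => by
      obtain ⟨h1, h2⟩ := hσ1 p hp
      have : (0 : ℝ) < 1 - p 0 ^ 2 := by nlinarith
      simpa using this.ne'
    exact (isSemialgebraicFunOn_aeval_div_aeval hσ 1 (1 - X 0 ^ 2) hq).congr fun p _ => by simp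
  have hΦb : Φ b = fun p => ![g b (p 0), p 1 * (h b (p 0) / S (p 0))] := funext (hΦ b)
  rw [hΦb]
  refine IsSemialgebraicMapOn.of_forall hσ (Fin.forall_fin_two.2 ⟨?_, ?_⟩)
  · simpa using hg'
  · refine (IsSemialgebraicFunOn.mul_holds (IsSemialgebraicFunOn.mul_holds
      (IsSemialgebraicFunOn.mul_holds (hx 1) hh') hS') hinv).congr fun p hp => ?_
    obtain ⟨h1, h2⟩ := hσ1 p hp
    have hSp : 0 < S (p 0) := threeTri_S_pos hS h1 h2
    have hS2 : S (p 0) ^ 2 = 1 - p 0 ^ 2 := threeTri_S_sq hS h1.le h2.le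
    simp only [Pi.mul_apply, Matrix.cons_val_one, Matrix.cons_val_zero]
    rw [← hS2]
    field_simp

/-- The rotation `Φ_b` is injective wherever `|x| < 1` and `h b x > 0` (`g b` is injective there, and the
second coordinate is linear in `t` with the non-zero slope `h b x / S x`). [folklore] -/
theorem threeTri_rot_injOn (hS : ∀ x, S x = Real.sqrt (1 - x ^ 2)) (hg : ∀ b x, g b x = b * x - S b * S x)
    (hh : ∀ b x, h b x = b * S x + S b * x) (hΦ : ∀ b p, Φ b p = ![g b (p 0), p 1 * (h b (p 0) / S (p 0))])
    {b : ℝ} {σ : Set (Fin 2 → ℝ)} (hσ : ∀ p ∈ σ, -1 < p 0 ∧ p 0 < 1 ∧ 0 < h b (p 0)) : InjOn (Φ b) σ := by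
  intro p hp q hq hpq
  obtain ⟨hp1, hp2, hp3⟩ := hσ p hp
  obtain ⟨hq1, hq2, hq3⟩ := hσ q hq
  have h0 := congrFun hpq 0
  have h1 := congrFun hpq 1
  simp only [hΦ, Matrix.cons_val_zero] at h0
  simp only [hΦ, Matrix.cons_val_one, Matrix.cons_val_zero] at h1
  have hx : p 0 = q 0 := threeTri_g_inj hS hg hh hp1.le hp2.le hq1.le hq2.le hp3 hq3 h0
  rw [← hx] at h1
  have hG : 0 < h b (p 0) / S (p 0) := div_pos hp3 (threeTri_S_pos hS hp1 hp2)
  have ht : p 1 = q 1 := mul_right_cancel₀ hG.ne' h1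
  funext i
  revert i
  rw [Fin.forall_fin_two]
  exact ⟨hx, ht⟩

/-- **The derivative of the rotation** `Φ_b` at a point with `|x| < 1`: the lower-triangular matrix
`[[G x, 0], [t · G' x, G x]]` with `G x = h b x / S x`, of determinant `(G x)²`. [folklore] -/
theorem threeTri_rot_hasFDerivAt (hS : ∀ x, S x = Real.sqrt (1 - x ^ 2))
    (hg : ∀ b x, g b x = b * x - S b * S x) (hh : ∀ b x, h b x = b * S x + S b * x)
    (hΦ : ∀ b p, Φ b p = ![g b (p 0), p 1 * (h b (p 0) / S (p 0))]) {b : ℝ} {p : Fin 2 → ℝ}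
    (hp : -1 < p 0) (hp' : p 0 < 1) :
    ∃ L : (Fin 2 → ℝ) →L[ℝ] (Fin 2 → ℝ), HasFDerivAt (Φ b) L p ∧ L.det = (h b (p 0) / S (p 0)) ^ 2 := by
  have hSx : 0 < S (p 0) := threeTri_S_pos hS hp hp'
  have h1x : (1 - p 0 ^ 2) ≠ 0 := by nlinarith
  -- derivative of `S` at `p 0`
  have hf : HasDerivAt (fun y : ℝ => 1 - y ^ 2) (-(2 * p 0)) (p 0) := by
    simpa using (hasDerivAt_pow 2 (p 0)).const_sub 1
  have hSd : HasDerivAt S (-(2 * p 0) / (2 * S (p 0))) (p 0) := by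
    rw [show S = fun y => Real.sqrt (1 - y ^ 2) from funext hS]
    exact hf.sqrt h1x
  -- the slope `G = h b / S` and the derivative of `g b`
  set G : ℝ → ℝ := fun y => h b y / S y with hG_def
  have hgd : HasDerivAt (g b) (G (p 0)) (p 0) := by
    rw [show g b = fun y => b * y - S b * S y from funext (hg b)]
    refine (((hasDerivAt_id (p 0)).const_mul b).sub (hSd.const_mul (S b))).congr_deriv ?_
    simp only [hG_def, hh]
    field_simp
    ring
  have hGd : DifferentiableAt ℝ G (p 0) := by
    have hhd : DifferentiableAt ℝ (h b) (p 0) := by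
      rw [show h b = fun y => b * S y + S b * y from funext (hh b)]
      exact (hSd.differentiableAt.const_mul b).add (differentiableAt_id.const_mul (S b))
    exact hhd.div hSd.differentiableAt hSx.ne'
  have hGD : HasDerivAt G (deriv G (p 0)) (p 0) := hGd.hasDerivAt
  set M : Matrix (Fin 2) (Fin 2) ℝ := !![G (p 0), 0; p 1 * deriv G (p 0), G (p 0)] with hM
  refine ⟨LinearMap.toContinuousLinearMap (Matrix.toLin' M), ?_, ?_⟩
  · rw [show Φ b = fun q => ![g b (q 0), q 1 * G (q 0)] from funext (hΦ b), hasFDerivAt_pi']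
    refine Fin.forall_fin_two.2 ⟨?_, ?_⟩
    · have h0 := HasDerivAt.comp_hasFDerivAt (f := fun q : Fin 2 → ℝ => q 0) p hgd
        (hasFDerivAt_apply (𝕜 := ℝ) 0 p)
      refine h0.congr_fderiv (ContinuousLinearMap.ext fun v => ?_)
      simp [hM, dotProduct, Fin.sum_univ_two]
    · have hA := hasFDerivAt_apply (𝕜 := ℝ) (1 : Fin 2) p
      have hB := HasDerivAt.comp_hasFDerivAt (f := fun q : Fin 2 → ℝ => q 0) p hGD
        (hasFDerivAt_apply (𝕜 := ℝ) 0 p)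
      refine (hA.mul hB).congr_fderiv (ContinuousLinearMap.ext fun v => ?_)
      simp [hM, dotProduct, Fin.sum_univ_two]
      ring
  · rw [LinearMap.det_toContinuousLinearMap, LinearMap.det_toLin', hM, Matrix.det_fin_two_of]
    ring

/-- **The image of the standard triangle under the rotation**: for `|a|, |b| < 1` with `0 ≤ a + b`,
`Φ_b '' Std a = {g a b < x < b, 0 < t, 1 < x² + t²}` (the boundary arc `θ ∈ (0, A)` goes to `θ ∈ (B, A + B)`,
the vertical direction is preserved). [folklore] -/
theorem threeTri_rot_image (hS : ∀ x, S x = Real.sqrt (1 - x ^ 2)) (hg : ∀ b x, g b x = b * x - S b * S x)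
    (hh : ∀ b x, h b x = b * S x + S b * x) (hΦ : ∀ b p, Φ b p = ![g b (p 0), p 1 * (h b (p 0) / S (p 0))])
    {a b : ℝ} (ha : -1 < a) (ha' : a < 1) (hb : -1 < b) (hb' : b < 1) (hab : 0 ≤ a + b) :
    Φ b '' {p : Fin 2 → ℝ | a < p 0 ∧ p 0 < 1 ∧ 0 < p 1 ∧ 1 < (p 0 - 0) ^ 2 + p 1 ^ 2} =
      {p | g a b < p 0 ∧ p 0 < b ∧ 0 < p 1 ∧ 1 < (p 0 - 0) ^ 2 + p 1 ^ 2} := by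
  have hSa : 0 < S a := threeTri_S_pos hS ha ha'
  have hSb : 0 < S b := threeTri_S_pos hS hb hb'
  have hha : 0 ≤ h b a := threeTri_h_nonneg hS hh hb hb' ha'.le (by linarith)
  -- `c' = g a b = g b a` and its basic bounds
  have hc'b : g b a < b := threeTri_g_lt_self hS hg hh ha ha' hb hb' hab
  have hc'1 : -1 ≤ g b a := threeTri_neg_one_le_g hS hg hh ha.le ha'.le hb.le hb'.le
  -- `G (c') = a` and `h b (-c') = S a`
  obtain ⟨-, hg0, hh0⟩ := threeTri_boundaryTrig S g h hS hg hh b (-a) hb.le hb'.le (by linarith) (by linarith)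
    (by rw [neg_neg]; exact hha)
  rw [neg_neg] at hg0 hh0
  rw [threeTri_S_neg hS] at hh0
  have hGc : -g b (-g b a) = a := by linarith
  have hkc : h b (-g b a) = S a := hh0
  rw [threeTri_g_comm hg a b]
  ext q
  simp only [mem_image, mem_setOf_eq, sub_zero, hΦ]
  constructor
  · rintro ⟨p, ⟨h1, h2, h3, h4⟩, rfl⟩
    have hx1 : -1 < p 0 := by linarith
    have hSx : 0 < S (p 0) := threeTri_S_pos hS hx1 h2
    have hhx : 0 < h b (p 0) := threeTri_h_pos hS hh hb hb' h2.le (by linarith)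
    have hS2 : S (p 0) ^ 2 = 1 - p 0 ^ 2 := threeTri_S_sq hS hx1.le h2.le
    have htS : S (p 0) < p 1 := lt_of_pow_lt_pow_left₀ 2 h3.le (by rw [hS2]; linarith)
    have hG : 0 < h b (p 0) / S (p 0) := div_pos hhx hSx
    simp only [Matrix.cons_val_zero, Matrix.cons_val_one]
    refine ⟨?_, ?_, mul_pos h3 hG, ?_⟩
    · exact threeTri_g_lt_g hS hg hh (b := b) hx1.le h2.le ha.le ha'.le h1 (by linarith) (by linarith)
    · have h5 : 0 < h b 1 + h b (p 0) := by rw [threeTri_h_one hS hh]; linarith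
      have h6 : 0 < S 1 + S (p 0) := by rw [threeTri_S_one hS]; linarith
      have := threeTri_g_lt_g hS hg hh (b := b) (by norm_num) le_rfl hx1.le h2.le h2 h5 h6
      rwa [threeTri_g_one hS hg] at this
    · -- `(t · G)² > h² = 1 − g²`
      have hgh := threeTri_g_sq_add_h_sq hS hg hh hb.le hb'.le hx1.le h2.le
      have hlt : h b (p 0) < p 1 * (h b (p 0) / S (p 0)) := by
        have : p 1 * (h b (p 0) / S (p 0)) - h b (p 0) = h b (p 0) * (p 1 - S (p 0)) / S (p 0) := by
          field_simp
        have hpos : 0 < h b (p 0) * (p 1 - S (p 0)) / S (p 0) := div_pos (mul_pos hhx (by linarith)) hSx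
        linarith
      nlinarith
  · rintro ⟨h1, h2, h3, h4⟩
    have hy1 : -1 < q 0 := by linarith
    have hy2 : q 0 < 1 := by linarith
    have hSy : 0 < S (q 0) := threeTri_S_pos hS hy1 hy2
    have hSy2 : S (q 0) ^ 2 = 1 - q 0 ^ 2 := threeTri_S_sq hS hy1.le hy2.le
    have hτ : S (q 0) < q 1 := lt_of_pow_lt_pow_left₀ 2 h3.le (by rw [hSy2]; linarith)
    -- the inverse point
    have hk : 0 < h b (-q 0) := threeTri_h_pos hS hh hb hb' (by linarith) (by linarith)
    obtain ⟨hSx, hgx, hhx⟩ := threeTri_boundaryTrig S g h hS hg hh b (q 0) hb.le hb'.le hy1.le hy2.le hk.le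
    set x : ℝ := -g b (-q 0) with hx_def
    have hx : -1 < x ∧ x < 1 := threeTri_abs_lt_of_S_pos hS (by rw [hSx]; exact hk)
    set t : ℝ := q 1 * h b (-q 0) / S (q 0) with ht_def
    have hkt : h b (-q 0) < t := by
      rw [ht_def, lt_div_iff₀ hSy]
      nlinarith
    refine ⟨![x, t], ⟨?_, hx.2, ?_, ?_⟩, ?_⟩
    · -- `a = G c' < G y = x`
      simp only [Matrix.cons_val_zero]
      rw [← hGc, hx_def, neg_lt_neg_iff]
      refine threeTri_g_lt_g hS hg hh (b := b) (by linarith) (by linarith) (by linarith) (by linarith)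
        (by linarith) ?_ ?_
      · rw [hkc]; linarith
      · linarith [threeTri_S_nonneg hS (-g b a), threeTri_S_pos hS (by linarith : -1 < -q 0) (by linarith)]
    · simp only [Matrix.cons_val_one, Matrix.cons_val_zero]
      linarith
    · simp only [Matrix.cons_val_zero, Matrix.cons_val_one]
      have hS2 : S x ^ 2 = 1 - x ^ 2 := threeTri_S_sq hS hx.1.le hx.2.le
      rw [hSx] at hS2
      nlinarith
    · simp only [Matrix.cons_val_one, Matrix.cons_val_zero, hgx, hhx, hSx, ht_def]
      funext i
      revert i
      rw [Fin.forall_fin_two]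
      refine ⟨by simp, ?_⟩
      simp only [Matrix.cons_val_one, Matrix.cons_val_zero]
      field_simp

/-- **The rotation move** (binder form). For real algebraic `b` and `|a|, |b| < 1` with `0 ≤ a + b`: any
representation `r = [Std a, t⁻²]` is KZ-equivalent to any representation `r'` of
`[{g a b < x < b, 0 < t, 1 < x² + t²}, t⁻²]`, by ONE change of variables (rule (2)) along the boundary rotation
`Φ_b` (`ℚ`-semialgebraic, injective, with derivative of determinant `(h b x / S x)²`, image the target V-piece,
and `t⁻² = (t · h/S)⁻² · (h/S)²`). [cite: KontsevichZagier2001, §1.2 rule (2)] -/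
theorem threeTri_rotMove (hS : ∀ x, S x = Real.sqrt (1 - x ^ 2)) (hg : ∀ b x, g b x = b * x - S b * S x)
    (hh : ∀ b x, h b x = b * S x + S b * x) (hΦ : ∀ b p, Φ b p = ![g b (p 0), p 1 * (h b (p 0) / S (p 0))])
    {a b : ℝ} (hbalg : IsAlgebraic ℚ b) (ha : -1 < a) (ha' : a < 1) (hb : -1 < b) (hb' : b < 1)
    (hab : 0 ≤ a + b) (r r' : KZ.IntegralRep 2)
    (hr : r.domain = {p | a < p 0 ∧ p 0 < 1 ∧ 0 < p 1 ∧ 1 < (p 0 - 0) ^ 2 + p 1 ^ 2})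
    (hri : EqOn r.integrand (fun p => 1 / p 1 ^ 2) r.domain)
    (hr' : r'.domain = {p | g a b < p 0 ∧ p 0 < b ∧ 0 < p 1 ∧ 1 < (p 0 - 0) ^ 2 + p 1 ^ 2})
    (hri' : EqOn r'.integrand (fun p => 1 / p 1 ^ 2) r'.domain) : KZ.Equivalent r r' := by
  have hσ1 : ∀ p ∈ r.domain, -1 < p 0 ∧ p 0 < 1 := fun p hp => by
    rw [hr] at hp
    exact ⟨by linarith [hp.1], hp.2.1⟩
  have hσ2 : ∀ p ∈ r.domain, -1 < p 0 ∧ p 0 < 1 ∧ 0 < h b (p 0) := fun p hp => by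
    refine ⟨(hσ1 p hp).1, (hσ1 p hp).2, ?_⟩
    rw [hr] at hp
    exact threeTri_h_pos hS hh hb hb' hp.2.1.le (by linarith [hp.1])
  -- a derivative at every point of the domain (chosen arbitrarily elsewhere)
  have hex : ∀ p : Fin 2 → ℝ, ∃ L : (Fin 2 → ℝ) →L[ℝ] (Fin 2 → ℝ), (-1 < p 0 ∧ p 0 < 1) →
      HasFDerivAt (Φ b) L p ∧ L.det = (h b (p 0) / S (p 0)) ^ 2 := by
    intro p
    by_cases hp : -1 < p 0 ∧ p 0 < 1
    · obtain ⟨L, hL⟩ := threeTri_rot_hasFDerivAt hS hg hh hΦ (b := b) hp.1 hp.2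
      exact ⟨L, fun _ => hL⟩
    · exact ⟨0, fun h' => (hp h').elim⟩
  choose L hL using hex
  have himg : r'.domain = Φ b '' r.domain := by
    rw [hr', hr, threeTri_rot_image hS hg hh hΦ ha ha' hb hb' hab]
  refine KZ.changeOfVariablesRel_subset_relations ⟨2, r, r', Φ b, L,
    threeTri_rot_isSemialgebraicMapOn hS hg hh hΦ hbalg r.isSemialgebraic_domain hσ1,
    fun p hp => ((hL p (hσ1 p hp)).1).hasFDerivWithinAt, threeTri_rot_injOn hS hg hh hΦ hσ2, himg,
    fun p hp => ?_, rfl⟩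
  -- the Jacobian identity `t⁻² = (t · G)⁻² · G²`
  have hp' : Φ b p ∈ r'.domain := himg ▸ mem_image_of_mem _ hp
  obtain ⟨h1, h2, h3⟩ := hσ2 p hp
  have hS0 : S (p 0) ≠ 0 := (threeTri_S_pos hS h1 h2).ne'
  have hh0 : h b (p 0) ≠ 0 := h3.ne'
  have hG : 0 < h b (p 0) / S (p 0) := div_pos h3 (threeTri_S_pos hS h1 h2)
  have ht : p 1 ≠ 0 := by rw [hr] at hp; exact hp.2.2.1.ne'
  rw [hri hp, hri' hp', (hL p (hσ1 p hp)).2, abs_of_pos (pow_pos hG 2)]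
  simp only [hΦ, Matrix.cons_val_one, Matrix.cons_val_zero]
  field_simp


/-- **The rotation move** (registered helper goal of `stub_threeTriangles`). With `S x = √(1 − x²)`,
`g b x = b x − S b · S x`, `h b x = b · S x + S b · x` and the boundary rotation
`Φ b (x, t) = (g b x, t · h b x / S x)` of the upper half-plane: for real algebraic `b` and `|a|, |b| < 1` with
`0 ≤ a + b` (`arccos a + arccos b ≤ π`), every representation of `[Std a, t⁻²]`
(`Std a = {a < x < 1, 0 < t, 1 < x² + t²}`) is KZ-equivalent to every representation of the V-piece
`[{g a b < x < b, 0 < t, 1 < x² + t²}, t⁻²]` — ONE change of variables of Kontsevich–Zagier's rule (2) along `Φ b`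
(the `arccos`-area integral is translated along the boundary circle by the algebraic angle `arccos b`).
[cite: KontsevichZagier2001, §1.2 rule (2)] -/
theorem threeTri_rotationMove :
    ∀ (S : ℝ → ℝ) (g h : ℝ → ℝ → ℝ) (Φ : ℝ → (Fin 2 → ℝ) → Fin 2 → ℝ),
      (∀ x, S x = Real.sqrt (1 - x ^ 2)) → (∀ b x, g b x = b * x - S b * S x) →
      (∀ b x, h b x = b * S x + S b * x) → (∀ b p, Φ b p = ![g b (p 0), p 1 * (h b (p 0) / S (p 0))]) →
    ∀ (a b : ℝ), IsAlgebraic ℚ b → -1 < a → a < 1 → -1 < b → b < 1 → 0 ≤ a + b →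
    ∀ (r r' : KZ.IntegralRep 2),
      r.domain = {p | a < p 0 ∧ p 0 < 1 ∧ 0 < p 1 ∧ 1 < (p 0 - 0) ^ 2 + p 1 ^ 2} →
      EqOn r.integrand (fun p => 1 / p 1 ^ 2) r.domain →
      r'.domain = {p | g a b < p 0 ∧ p 0 < b ∧ 0 < p 1 ∧ 1 < (p 0 - 0) ^ 2 + p 1 ^ 2} →
      EqOn r'.integrand (fun p => 1 / p 1 ^ 2) r'.domain → KZ.Equivalent r r' := by
  intro S g h Φ hS hg hh hΦ a b hbalg ha ha' hb hb' hab r r' hr hri hr' hri'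
  exact threeTri_rotMove hS hg hh hΦ hbalg ha ha' hb hb' hab r r' hr hri hr' hri'

end Summit.KontsevichZagierPeriods.HyperbolicBloch.OffTetraSectorKernel

end
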